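import Summits.AtomisticToContinuum.BoseEinsteinCondensation.Theses.BECModePrice
import Summits.AtomisticToContinuum.BoseEinsteinCondensation.Theorems.BECModePriceDiluteEnergyBound
import Summits.AtomisticToContinuum.BoseEinsteinCondensation.Theorems.BECModePriceSofteningModeCount
import Summits.AtomisticToContinuum.BoseEinsteinCondensation.Theorems.BECModePriceModePriceHardCoreTowerShadow
import HarnessLib

/-!
# Calibre certificates for the crux `BECModePrice.ModePriceHardCore` (stmt-AtomisticToContinuum-18513) and for the last
# registered stub of its line `IdeatorSketchK1` (lead c1)

Kernel-checked CONSEQUENCES (necessity-type documentation, no `sorry`, no new definition) that fix the size of what is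
left open on this crux:

* `torusBEC_of_modePriceHardCore` — the crux ALONE (no other item of the route) gives, for every NON-integrable admissible
  potential (hard cores, strongly singular cores), Bose–Einstein condensation of the `δ`-near-minimisers on the torus in
  the thermodynamic limit at every small density (constant-mode occupation `≥ cN`): the SMS body feeds the route's landed
  mode count `softeningModeCount_proof` together with the landed crude energy bound `becModePrice_diluteEnergyBound_proof`.
  Torus BEC in the thermodynamic limit for hard spheres is the open problem of LSSY Ch. 5 / Chong–Liang–Nam 2025 p. 2
  ("proving BEC in the thermodynamic limit remains a major open problem"), so the crux is at least that hard.
* `torusBEC_of_scaleFree` — the line's last registered stub (scale-free integrable SMS) gives the same conclusion for EVERY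
  admissible potential, integrable or not (through `modePrice_both_of_scaleFree`).
* `boseEinsteinCondensation_of_scaleFree` — the stub plus the route's rank-4 crux `BoundaryTransferWeak` already yield the
  summit conjunct `BoseEinsteinCondensation` (the route's deciding theorem `closes` with both price cruxes discharged by the
  stub): the stub is summit-sized modulo boundary-condition transfer.

References: E. H. Lieb, R. Seiringer, J. P. Solovej, J. Yngvason, *The Mathematics of the Bose Gas and its Condensation*
(2005), §1.2 and Ch. 5 p. 42; J. J. Chong, H. Liang, P. T. Nam, arXiv:2510.20493 (2025), p. 2 and §2.3.
-/

noncomputable section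

namespace Summit.AtomisticToContinuum.BoseEinsteinCondensation.Cruxes.ModePriceHardCore.TowerShadow

open MeasureTheory Filter
open scoped ENNReal NNReal Topology
open Literature.MathematicalPhysics.QuantumManyBody.BoseGas
open Summit.AtomisticToContinuum.BoseEinsteinCondensation.Theses.BECModePrice

/-- **Calibre of the crux.** `ModePriceHardCore` alone implies torus BEC of near-minimisers in the thermodynamic limit for
every non-integrable admissible potential: for such `v` there is `ρ₀ > 0` such that for all `0 < ρ < ρ₀` some `c > 0`
bounds the constant-mode occupation of every `δ`-near-minimiser below by `cN`, eventually in `N` (composition of the SMS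
body with the landed `softeningModeCount_proof` and `becModePrice_diluteEnergyBound_proof`). [cite: LSSY2005, Ch. 5 p. 42] -/
theorem torusBEC_of_modePriceHardCore (h : ModePriceHardCore) :
    ∀ v : ℝ → ℝ≥0∞, IsRepulsiveFiniteRange v → (∫⁻ x : Space, v ‖x‖) = ⊤ →
      ∃ ρ₀ : ℝ, 0 < ρ₀ ∧ ∀ ρ : ℝ, 0 < ρ → ρ < ρ₀ → ∃ c : ℝ, 0 < c ∧ ∀ᶠ N : ℕ in atTop,
        ∃ δ : ℝ≥0∞, 0 < δ ∧ ∀ Ψ : PeriodicTrialState N (sideLength ρ N),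
          periodicEnergy v Ψ ≤ periodicGroundStateEnergy v N (sideLength ρ N) + δ →
            ENNReal.ofReal (c * N) ≤ condensateOccupation N (sideLength ρ N) Ψ.ψ :=
  fun v hv hint =>
    Theorems.softeningModeCount_proof v hv (h v hv hint) (Theorems.becModePrice_diluteEnergyBound_proof v hv)

/-- **Calibre of the last stub of line `IdeatorSketchK1`.** Scale-free integrable SMS (the registered stub
`stub_scaleFreeModePriceIntegrable`, as a hypothesis) implies torus BEC of near-minimisers in the thermodynamic limit for
EVERY admissible potential, integrable or not (`modePrice_both_of_scaleFree` + the landed mode count and energy bound).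
[cite: LSSY2005, Ch. 5 p. 42] -/
theorem torusBEC_of_scaleFree
    (hSF : ∀ R₀ : ℝ, 0 < R₀ → ∃ C : ℝ, 0 < C ∧ ∃ ρ₀ : ℝ, 0 < ρ₀ ∧ ∀ ρ : ℝ, 0 < ρ → ρ < ρ₀ →
      ∃ N₀ : ℕ, ∀ N : ℕ, N₀ ≤ N → ∀ p : Fin 3 → ℤ, p ≠ 0 →
        ∀ v : ℝ → ℝ≥0∞, IsRepulsiveFiniteRange v → (∀ r, R₀ < r → v r = 0) →
          (∫⁻ x : Space, v ‖x‖) ≠ ⊤ →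
          ∀ Ψ : PeriodicTrialState N (sideLength ρ N),
            periodicGroundStateEnergy v N (sideLength ρ N)
                + 2⁻¹ * fracDispersion 2 (sideLength ρ N) p
                  * cellOccupation N (sideLength ρ N) (planeWaveMode (sideLength ρ N) p) Ψ.ψ
              ≤ periodicEnergy v Ψ + ENNReal.ofReal (C * ρ)) :
    ∀ v : ℝ → ℝ≥0∞, IsRepulsiveFiniteRange v →
      ∃ ρ₀ : ℝ, 0 < ρ₀ ∧ ∀ ρ : ℝ, 0 < ρ → ρ < ρ₀ → ∃ c : ℝ, 0 < c ∧ ∀ᶠ N : ℕ in atTop,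
        ∃ δ : ℝ≥0∞, 0 < δ ∧ ∀ Ψ : PeriodicTrialState N (sideLength ρ N),
          periodicEnergy v Ψ ≤ periodicGroundStateEnergy v N (sideLength ρ N) + δ →
            ENNReal.ofReal (c * N) ≤ condensateOccupation N (sideLength ρ N) Ψ.ψ := by
  intro v hv
  obtain ⟨hI, hH⟩ := modePrice_both_of_scaleFree hSF
  refine Theorems.softeningModeCount_proof v hv ?_ (Theorems.becModePrice_diluteEnergyBound_proof v hv)
  by_cases hint : (∫⁻ x : Space, v ‖x‖) = ⊤
  · exact hH v hv hint
  · exact hI v hv hint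

/-- **The stub is summit-sized modulo boundary-condition transfer.** Scale-free integrable SMS together with the route's
rank-4 crux `BoundaryTransferWeak` gives the summit conjunct `BoseEinsteinCondensation` (the route's deciding theorem
`closes`, both price cruxes discharged by `modePrice_both_of_scaleFree`, the two supports by their landed proofs).
[cite: LSSY2005, §1.2 and Ch. 5 p. 42] -/
theorem boseEinsteinCondensation_of_scaleFree
    (hSF : ∀ R₀ : ℝ, 0 < R₀ → ∃ C : ℝ, 0 < C ∧ ∃ ρ₀ : ℝ, 0 < ρ₀ ∧ ∀ ρ : ℝ, 0 < ρ → ρ < ρ₀ →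
      ∃ N₀ : ℕ, ∀ N : ℕ, N₀ ≤ N → ∀ p : Fin 3 → ℤ, p ≠ 0 →
        ∀ v : ℝ → ℝ≥0∞, IsRepulsiveFiniteRange v → (∀ r, R₀ < r → v r = 0) →
          (∫⁻ x : Space, v ‖x‖) ≠ ⊤ →
          ∀ Ψ : PeriodicTrialState N (sideLength ρ N),
            periodicGroundStateEnergy v N (sideLength ρ N)
                + 2⁻¹ * fracDispersion 2 (sideLength ρ N) p
                  * cellOccupation N (sideLength ρ N) (planeWaveMode (sideLength ρ N) p) Ψ.ψ
              ≤ periodicEnergy v Ψ + ENNReal.ofReal (C * ρ))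
    (hBT : BoundaryTransferWeak) : _root_.BoseEinsteinCondensation :=
  closes (modePrice_both_of_scaleFree hSF).1 (modePrice_both_of_scaleFree hSF).2
    Theorems.becModePrice_diluteEnergyBound_proof Theorems.softeningModeCount_proof hBT

end Summit.AtomisticToContinuum.BoseEinsteinCondensation.Cruxes.ModePriceHardCore.TowerShadow

end
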